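import Mathlib
import HarnessLib
import Literature.Analysis.FluidPDE.NewtonPotentialHolder
import Summits.NavierStokesRegularity.NavierStokesRegularity.Theorems.ChiralWindowDoorDefs
import Summits.NavierStokesRegularity.NavierStokesRegularity.Theorems.CriticalFluxDoorDefs
import Summits.NavierStokesRegularity.NavierStokesRegularity.Theorems.ChiralWindowDoorLocalHelicityLower
import Summits.NavierStokesRegularity.NavierStokesRegularity.Theorems.ChiralWindowDoorHelicityFluxBounds
import Summits.NavierStokesRegularity.NavierStokesRegularity.Theorems.CriticalFluxDoorLambdaDecay

/-!
# Door S21-C «CriticalFluxDoor» — the commutator `[Λ, a_R]f` POINTWISE: the `z ↔ −z` pairing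
# (F3-DERIVATION §2 (c), near and annulus zones)

Door S21-C of nsreg-p1's local Type-I door family (`HOME/ns-regularity-ideate-p1/ROUND-20.md` §2b F3,
`r20/F3-DERIVATION.md` §2 (c); DESIGN-ONLY, route NOT born).  The commutator of `Λ` with the weight `a_R = η(·/R)²`,
`[Λ,a_R]f(x) = lamComm a_R f x = ½∫K(z)[(a_R(x)−a_R(x+z))f(x+z) + (a_R(x)−a_R(x−z))f(x−z)]dz` (`…CriticalFluxDoorDefs`),
is bounded pointwise after PAIRING `z ↔ −z`:
`(a(x)−a(x+z))f(x+z) + (a(x)−a(x−z))f(x−z) = ½·δ²a(x,z)·(f(x+z)+f(x−z)) + ½·(a(x−z)−a(x+z))·(f(x+z)−f(x−z))`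
(first order alone leaves `∫‖z‖⁻³`, log-divergent).  With `‖f‖ ≤ V` everywhere and `‖Df‖ ≤ G` on `‖y‖ ≥ R/2`:

  `‖[Λ,a_R]f(x)‖ ≤ c₁(η)·V/R + 1_{3R/4 ≤ ‖x‖}·c₂(η)·G`

(the second-difference term and the large-`z` part of the first-difference term are `O(V/R)` uniformly in `x`; the
small-`z` part of the first-difference term vanishes for `‖x‖ < 3R/4` — there `a_R(x±z) = 1` — and elsewhere sees only
`‖y‖ ≥ R/2`, where the gradient bound applies).

* `secondDiff_bumpSq_le`, `abs_secondDiff_bumpSq_le_two`, `abs_sub_bumpSq_le`, `bumpSq_shift_eq_one` — the weight;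
* `pairing_identity`, `norm_pairing_le` — the algebra;
* `exists_norm_lamComm_bumpSq_le` — **the pointwise bound** (constants depend on `η` only).

Seat nsreg-p6 g13 (THEOREMS-ONLY door sequels, DIRECTOR-NS g8 #32 (2)/#36).  WHAT THIS IS NOT: not NS regularity (Clay A);
kernel bookkeeping; the far zone and the time integration are the next files; no route is opened.
-/

noncomputable section

-- the summit and its single sub-problem share the name (CONVENTIONS §1), as in every Theorems file
set_option linter.dupNamespace false

namespace Summit.NavierStokesRegularity.NavierStokesRegularity.Theorems.CriticalFluxDoorCommutatorPointwise

open MeasureTheory Metric Set Filter Topology Function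
open scoped RealInnerProductSpace
open Literature.Analysis Literature.Analysis.FluidPDE
open Summit.NavierStokesRegularity.NavierStokesRegularity.Theorems.ChiralWindowDoorDefs
open Summit.NavierStokesRegularity.NavierStokesRegularity.Theorems.CriticalFluxDoorDefs
open Summit.NavierStokesRegularity.NavierStokesRegularity.Theorems.ChiralWindowDoorLocalHelicityLower
  (bumpSq_eq_comp_one contDiff_bumpSq exists_secondDiff_bound_bumpSq)
open Summit.NavierStokesRegularity.NavierStokesRegularity.Theorems.ChiralWindowDoorHelicityFluxBounds
  (exists_norm_fderiv_bumpSq_le)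
open Summit.NavierStokesRegularity.NavierStokesRegularity.Theorems.CriticalFluxDoorLambdaDecay (lamK_eq_rpow)

variable {η : EuclideanSpace ℝ (Fin 3) → ℝ}

/-! ### The weight `a_R`: second and first differences, the plateau -/

/-- Second differences scale: `|2a_R(x) − a_R(x+z) − a_R(x−z)| ≤ A₂ R⁻² ‖z‖²` with the constant `A₂` of `a₁`. -/
theorem secondDiff_bumpSq_le {A₂ : ℝ}
    (hA₂ : ∀ x z : EuclideanSpace ℝ (Fin 3), |2 * bumpSq η 1 x - bumpSq η 1 (x + z) - bumpSq η 1 (x - z)| ≤ A₂ * ‖z‖ ^ 2)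
    {R : ℝ} (hR : 0 < R) (x z : EuclideanSpace ℝ (Fin 3)) :
    |2 * bumpSq η R x - bumpSq η R (x + z) - bumpSq η R (x - z)| ≤ A₂ * R⁻¹ ^ 2 * ‖z‖ ^ 2 := by
  rw [bumpSq_eq_comp_one η R x, bumpSq_eq_comp_one η R (x + z), bumpSq_eq_comp_one η R (x - z), smul_add, smul_sub]
  have h := hA₂ (R⁻¹ • x) (R⁻¹ • z)
  rw [norm_smul, Real.norm_eq_abs, abs_of_pos (inv_pos.2 hR), mul_pow, ← mul_assoc] at h
  exact h

/-- `|2a_R(x) − a_R(x+z) − a_R(x−z)| ≤ 2` (values in `[0,1]`). -/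
theorem abs_secondDiff_bumpSq_le_two (hη : IsAdmissibleBump η) (R : ℝ) (x z : EuclideanSpace ℝ (Fin 3)) :
    |2 * bumpSq η R x - bumpSq η R (x + z) - bumpSq η R (x - z)| ≤ 2 := by
  have h0 := bumpSq_nonneg η R x
  have h1 := bumpSq_le_one hη R x
  have h2 := bumpSq_nonneg η R (x + z)
  have h3 := bumpSq_le_one hη R (x + z)
  have h4 := bumpSq_nonneg η R (x - z)
  have h5 := bumpSq_le_one hη R (x - z)
  rw [abs_le]; constructor <;> linarith

/-- First differences: `|a_R(x−z) − a_R(x+z)| ≤ 2M₁‖z‖/R` (mean value, `‖∇a_R‖ ≤ M₁/R`) and `≤ 1`. -/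
theorem abs_sub_bumpSq_le (hη : IsAdmissibleBump η) {M₁ : ℝ} (hM : ∀ R > (0 : ℝ), ∀ x, ‖fderiv ℝ (bumpSq η R) x‖ ≤ M₁ / R)
    {R : ℝ} (hR : 0 < R) (x z : EuclideanSpace ℝ (Fin 3)) :
    |bumpSq η R (x - z) - bumpSq η R (x + z)| ≤ 2 * M₁ * R⁻¹ * ‖z‖ ∧ |bumpSq η R (x - z) - bumpSq η R (x + z)| ≤ 1 := by
  refine ⟨?_, ?_⟩
  · have hd : Differentiable ℝ (bumpSq η R) := (contDiff_bumpSq hη R).differentiable (by norm_num)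
    have h := Convex.norm_image_sub_le_of_norm_fderiv_le (fun y _ => hd y) (fun y _ => hM R hR y) convex_univ
      (mem_univ (x + z)) (mem_univ (x - z))
    rw [Real.norm_eq_abs, show x - z - (x + z) = -((2 : ℝ) • z) by rw [two_smul]; abel, norm_neg, norm_smul,
      Real.norm_eq_abs, abs_of_pos (by norm_num : (0 : ℝ) < 2)] at h
    calc |bumpSq η R (x - z) - bumpSq η R (x + z)| ≤ M₁ / R * (2 * ‖z‖) := h
      _ = 2 * M₁ * R⁻¹ * ‖z‖ := by rw [div_eq_mul_inv]; ring
  · have h2 := bumpSq_nonneg η R (x + z)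
    have h3 := bumpSq_le_one hη R (x + z)
    have h4 := bumpSq_nonneg η R (x - z)
    have h5 := bumpSq_le_one hη R (x - z)
    rw [abs_le]; constructor <;> linarith

/-- On the plateau: if `‖z‖ ≤ R/4` and `‖x‖ < 3R/4` then `a_R(x+z) = a_R(x−z) = 1`. -/
theorem bumpSq_shift_eq_one (hη : IsAdmissibleBump η) {R : ℝ} (hR : 0 < R) {x z : EuclideanSpace ℝ (Fin 3)}
    (hz : ‖z‖ ≤ R / 4) (hx : ‖x‖ < 3 * R / 4) : bumpSq η R (x + z) = 1 ∧ bumpSq η R (x - z) = 1 := by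
  refine ⟨bumpSq_eq_one hη hR ?_, bumpSq_eq_one hη hR ?_⟩
  · linarith [norm_add_le x z]
  · linarith [norm_sub_le x z]

/-! ### The pairing -/

/-- **Pairing identity**:
`(α−β₊)v₊ + (α−β₋)v₋ = ½(2α−β₊−β₋)(v₊+v₋) + ½(β₋−β₊)(v₊−v₋)`. -/
theorem pairing_identity (α βp βm : ℝ) (vp vm : EuclideanSpace ℝ (Fin 3)) :
    (α - βp) • vp + (α - βm) • vm =
      (1 / 2 : ℝ) • ((2 * α - βp - βm) • (vp + vm)) + (1 / 2 : ℝ) • ((βm - βp) • (vp - vm)) := by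
  module

/-- **Norm of the paired integrand**: `‖(α−β₊)v₊ + (α−β₋)v₋‖ ≤ ½|2α−β₊−β₋|(‖v₊‖+‖v₋‖) + ½|β₋−β₊|‖v₊−v₋‖`. -/
theorem norm_pairing_le (α βp βm : ℝ) (vp vm : EuclideanSpace ℝ (Fin 3)) :
    ‖(α - βp) • vp + (α - βm) • vm‖ ≤
      (1 / 2 : ℝ) * (|2 * α - βp - βm| * (‖vp‖ + ‖vm‖)) + (1 / 2 : ℝ) * (|βm - βp| * ‖vp - vm‖) := by
  rw [pairing_identity]
  refine (norm_add_le _ _).trans (add_le_add ?_ ?_)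
  · rw [norm_smul, norm_smul, Real.norm_eq_abs, Real.norm_eq_abs, abs_of_pos (by norm_num : (0 : ℝ) < 1 / 2)]
    gcongr
    exact norm_add_le _ _
  · rw [norm_smul, norm_smul, Real.norm_eq_abs, Real.norm_eq_abs, abs_of_pos (by norm_num : (0 : ℝ) < 1 / 2)]

/-! ### The pointwise commutator bound -/

/-- **Pointwise bound for `[Λ, a_R]f`** (near and annulus zones): there are `c₁, c₂ ≥ 0` depending on `η` only such
that for every `R > 0`, every differentiable field `f` with `‖f‖ ≤ V` everywhere and `‖Df(y)‖ ≤ G` on `‖y‖ ≥ R/2`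
(`G ≥ 0`), and every `x`:
`‖lamComm a_R f x‖ ≤ c₁·V/R + (if 3R/4 ≤ ‖x‖ then c₂·G else 0)`. -/
theorem exists_norm_lamComm_bumpSq_le (hη : IsAdmissibleBump η) :
    ∃ c₁ c₂ : ℝ, 0 ≤ c₁ ∧ 0 ≤ c₂ ∧ ∀ R > (0 : ℝ), ∀ (f : EuclideanSpace ℝ (Fin 3) → EuclideanSpace ℝ (Fin 3)) (V G : ℝ),
      Differentiable ℝ f → (∀ y, ‖f y‖ ≤ V) → 0 ≤ G → (∀ y, R / 2 ≤ ‖y‖ → ‖fderiv ℝ f y‖ ≤ G) →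
      ∀ x : EuclideanSpace ℝ (Fin 3),
        ‖lamComm (bumpSq η R) f x‖ ≤ c₁ * V / R + (if 3 * R / 4 ≤ ‖x‖ then c₂ * G else 0) := by
  obtain ⟨A₂, hA₂⟩ := exists_secondDiff_bound_bumpSq hη one_pos
  obtain ⟨M₁, hM₁0, hM₁⟩ := exists_norm_fderiv_bumpSq_le hη
  have hA₂0 : 0 ≤ A₂ := by
    by_contra h
    push Not at h
    obtain ⟨z, hz⟩ : ∃ z : EuclideanSpace ℝ (Fin 3), z ≠ 0 := exists_ne 0
    have h1 := hA₂ 0 z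
    have : A₂ * ‖z‖ ^ 2 < 0 := mul_neg_of_neg_of_pos h (by positivity)
    linarith [abs_nonneg (2 * bumpSq η 1 0 - bumpSq η 1 (0 + z) - bumpSq η 1 (0 - z))]
  set Bv : ℝ := (volume : Measure (EuclideanSpace ℝ (Fin 3))).real (ball 0 1) with hBv
  have hBv0 : 0 ≤ Bv := measureReal_nonneg
  -- the two constants
  set c₁ : ℝ := (1 / 2 : ℝ) * (3 * Bv / Real.pi ^ 2) * (A₂ / 4 + 12) with hc₁
  set c₂ : ℝ := (1 / 2 : ℝ) * (3 * Bv / Real.pi ^ 2) * M₁ with hc₂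
  refine ⟨c₁, c₂, by positivity, by positivity, fun R hR f V G hfd hV hG0 hG x => ?_⟩
  have hV0 : 0 ≤ V := (norm_nonneg _).trans (hV 0)
  have hRi : 0 < R⁻¹ := inv_pos.2 hR
  set ρ : ℝ := R / 4 with hρ
  have hρ0 : 0 < ρ := by positivity
  -- the gradient constant seen by the small-`z` first-difference term
  set G' : ℝ := if 3 * R / 4 ≤ ‖x‖ then G else 0 with hG'
  have hG'0 : 0 ≤ G' := by rw [hG']; split_ifs <;> [exact hG0; exact le_rfl]
  -- the majorant
  set κn : ℝ := 1 / Real.pi ^ 2 * (A₂ * R⁻¹ ^ 2 * V + 2 * M₁ * R⁻¹ * G') with hκn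
  set κf : ℝ := 1 / Real.pi ^ 2 * (3 * V) with hκf
  have hκn0 : 0 ≤ κn := by positivity
  have hκf0 : 0 ≤ κf := by positivity
  set m : EuclideanSpace ℝ (Fin 3) → ℝ := fun z =>
    (ball (0 : EuclideanSpace ℝ (Fin 3)) ρ).indicator (fun z => κn * ‖z‖ ^ (-(2 : ℝ))) z +
      (ball (0 : EuclideanSpace ℝ (Fin 3)) ρ)ᶜ.indicator (fun z => κf * ‖z‖ ^ (-(4 : ℝ))) z with hm
  -- integrability and integral of the majorant
  have hmi : Integrable m := by
    refine Integrable.add ?_ ?_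
    · rw [integrable_indicator_iff measurableSet_ball]
      exact (NewtonPotentialHolder.integrableOn_ball_norm_rpow_neg (by norm_num) ρ).const_mul κn
    · rw [integrable_indicator_iff measurableSet_ball.compl]
      exact (NewtonPotentialHolder.integrableOn_compl_ball_norm_rpow_neg (by norm_num) hρ0).const_mul κf
  have hmval : ∫ z, m z = κn * (3 * Bv * ρ) + κf * (3 * Bv * ρ⁻¹) := by
    rw [hm, integral_add]
    · rw [integral_indicator measurableSet_ball, integral_const_mul,
        NewtonPotentialHolder.integral_ball_norm_rpow_neg (by norm_num) hρ0, ← hBv,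
        integral_indicator measurableSet_ball.compl, integral_const_mul,
        NewtonPotentialHolder.integral_compl_ball_norm_rpow_neg (by norm_num) hρ0, ← hBv,
        show (3 : ℝ) - 2 = 1 by norm_num, Real.rpow_one, show (3 : ℝ) - 4 = -1 by norm_num, Real.rpow_neg_one]
      ring
    · rw [integrable_indicator_iff measurableSet_ball]
      exact (NewtonPotentialHolder.integrableOn_ball_norm_rpow_neg (by norm_num) ρ).const_mul κn
    · rw [integrable_indicator_iff measurableSet_ball.compl]
      exact (NewtonPotentialHolder.integrableOn_compl_ball_norm_rpow_neg (by norm_num) hρ0).const_mul κf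
  -- POINTWISE DOMINATION of the commutator integrand by `m`
  have hdom : ∀ z, ‖lamK z • ((bumpSq η R x - bumpSq η R (x + z)) • f (x + z) +
      (bumpSq η R x - bumpSq η R (x - z)) • f (x - z))‖ ≤ m z := by
    intro z
    rw [norm_smul, Real.norm_eq_abs, abs_of_nonneg (lamK_nonneg z)]
    have hpair := norm_pairing_le (bumpSq η R x) (bumpSq η R (x + z)) (bumpSq η R (x - z)) (f (x + z)) (f (x - z))
    obtain ⟨hdiff₁, hdiff₂⟩ := abs_sub_bumpSq_le hη hM₁ hR x z
    have hsd2 := abs_secondDiff_bumpSq_le_two hη R x z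
    have hsdA := secondDiff_bumpSq_le hA₂ hR x z
    have hvsum : ‖f (x + z)‖ + ‖f (x - z)‖ ≤ 2 * V := by linarith [hV (x + z), hV (x - z)]
    have hvdiff : ‖f (x + z) - f (x - z)‖ ≤ 2 * V := (norm_sub_le _ _).trans hvsum
    by_cases hzρ : ‖z‖ < ρ
    · -- small `z`: second differences `≤ A₂R⁻²‖z‖²`, first differences see the gradient on `‖y‖ ≥ R/2` or vanish
      have hzb : z ∈ ball (0 : EuclideanSpace ℝ (Fin 3)) ρ := mem_ball_zero_iff.2 hzρ
      have hzc : z ∉ (ball (0 : EuclideanSpace ℝ (Fin 3)) ρ)ᶜ := fun h => h hzb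
      have hmz : m z = κn * ‖z‖ ^ (-(2 : ℝ)) := by
        rw [hm]; dsimp only; rw [indicator_of_mem hzb, indicator_of_notMem hzc, add_zero]
      -- the first-difference term
      have hT2 : |bumpSq η R (x - z) - bumpSq η R (x + z)| * ‖f (x + z) - f (x - z)‖ ≤
          2 * M₁ * R⁻¹ * ‖z‖ * (2 * ‖z‖ * G') := by
        by_cases hx : 3 * R / 4 ≤ ‖x‖
        · have hG'eq : G' = G := by rw [hG', if_pos hx]
          -- mean value on the closed ball `B̄(x, ‖z‖) ⊆ {‖y‖ ≥ R/2}`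
          have hball : ∀ y ∈ closedBall x ‖z‖, R / 2 ≤ ‖y‖ := by
            intro y hy
            rw [mem_closedBall, dist_eq_norm] at hy
            have : ‖x‖ ≤ ‖y‖ + ‖y - x‖ := by
              calc ‖x‖ = ‖y - (y - x)‖ := by rw [sub_sub_cancel]
                _ ≤ ‖y‖ + ‖y - x‖ := norm_sub_le _ _
            rw [hρ] at hzρ
            linarith
          have hmvt := Convex.norm_image_sub_le_of_norm_fderiv_le (fun y _ => hfd y) (fun y hy => hG y (hball y hy))
            (convex_closedBall x ‖z‖)
            (show x - z ∈ closedBall x ‖z‖ by rw [mem_closedBall, dist_eq_norm, sub_sub_cancel_left, norm_neg])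
            (show x + z ∈ closedBall x ‖z‖ by rw [mem_closedBall, dist_eq_norm, add_sub_cancel_left])
          rw [show x + z - (x - z) = (2 : ℝ) • z by rw [two_smul]; abel, norm_smul, Real.norm_eq_abs,
            abs_of_pos (by norm_num : (0 : ℝ) < 2)] at hmvt
          rw [hG'eq]
          calc |bumpSq η R (x - z) - bumpSq η R (x + z)| * ‖f (x + z) - f (x - z)‖
              ≤ 2 * M₁ * R⁻¹ * ‖z‖ * (G * (2 * ‖z‖)) := mul_le_mul hdiff₁ hmvt (norm_nonneg _) (by positivity)
            _ = 2 * M₁ * R⁻¹ * ‖z‖ * (2 * ‖z‖ * G) := by ring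
        · push Not at hx
          obtain ⟨e1, e2⟩ := bumpSq_shift_eq_one hη hR hzρ.le hx
          rw [e1, e2, sub_self, abs_zero, zero_mul]
          positivity
      -- the second-difference term
      have hT1 : |2 * bumpSq η R x - bumpSq η R (x + z) - bumpSq η R (x - z)| * (‖f (x + z)‖ + ‖f (x - z)‖) ≤
          A₂ * R⁻¹ ^ 2 * ‖z‖ ^ 2 * (2 * V) := mul_le_mul hsdA hvsum (by positivity) (by positivity)
      rw [hmz]
      by_cases hz0 : z = 0
      · subst hz0
        simp only [lamK, norm_zero, ne_eq, OfNat.ofNat_ne_zero, not_false_eq_true, zero_pow, inv_zero, mul_zero,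
          zero_mul]
        positivity
      have hzpos : 0 < ‖z‖ := norm_pos_iff.2 hz0
      have hK : lamK z = 1 / Real.pi ^ 2 * ‖z‖ ^ (-(4 : ℝ)) := lamK_eq_rpow hz0
      have hr4 : ‖z‖ ^ (-(4 : ℝ)) = (‖z‖ ^ 2 * ‖z‖ ^ 2)⁻¹ := by
        rw [Real.rpow_neg hzpos.le, show (4 : ℝ) = ((4 : ℕ) : ℝ) by norm_num, Real.rpow_natCast]; ring
      have hr2 : ‖z‖ ^ (-(2 : ℝ)) = (‖z‖ ^ 2)⁻¹ := by
        rw [Real.rpow_neg hzpos.le, show (2 : ℝ) = ((2 : ℕ) : ℝ) by norm_num, Real.rpow_natCast]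
      rw [hK, hr4, hr2, hκn]
      have hz2 : 0 < ‖z‖ ^ 2 := by positivity
      calc 1 / Real.pi ^ 2 * (‖z‖ ^ 2 * ‖z‖ ^ 2)⁻¹ *
            ‖(bumpSq η R x - bumpSq η R (x + z)) • f (x + z) + (bumpSq η R x - bumpSq η R (x - z)) • f (x - z)‖
          ≤ 1 / Real.pi ^ 2 * (‖z‖ ^ 2 * ‖z‖ ^ 2)⁻¹ *
              ((1 / 2 : ℝ) * (A₂ * R⁻¹ ^ 2 * ‖z‖ ^ 2 * (2 * V)) +
                (1 / 2 : ℝ) * (2 * M₁ * R⁻¹ * ‖z‖ * (2 * ‖z‖ * G'))) := by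
            gcongr
            exact hpair.trans (by gcongr)
        _ = 1 / Real.pi ^ 2 * (A₂ * R⁻¹ ^ 2 * V + 2 * M₁ * R⁻¹ * G') * (‖z‖ ^ 2)⁻¹ := by
            field_simp
    · -- large `z`: crude bounds
      push Not at hzρ
      have hzpos : 0 < ‖z‖ := hρ0.trans_le hzρ
      have hz0 : z ≠ 0 := norm_pos_iff.1 hzpos
      have hzc : z ∈ (ball (0 : EuclideanSpace ℝ (Fin 3)) ρ)ᶜ := by
        rw [mem_compl_iff, mem_ball_zero_iff]; exact not_lt.2 hzρ
      have hzb : z ∉ ball (0 : EuclideanSpace ℝ (Fin 3)) ρ := hzc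
      have hmz : m z = κf * ‖z‖ ^ (-(4 : ℝ)) := by
        rw [hm]; dsimp only; rw [indicator_of_notMem hzb, indicator_of_mem hzc, zero_add]
      have hK : lamK z = 1 / Real.pi ^ 2 * ‖z‖ ^ (-(4 : ℝ)) := lamK_eq_rpow hz0
      have hT1 : |2 * bumpSq η R x - bumpSq η R (x + z) - bumpSq η R (x - z)| * (‖f (x + z)‖ + ‖f (x - z)‖) ≤
          2 * (2 * V) := mul_le_mul hsd2 hvsum (by positivity) (by norm_num)
      have hT2 : |bumpSq η R (x - z) - bumpSq η R (x + z)| * ‖f (x + z) - f (x - z)‖ ≤ 1 * (2 * V) :=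
        mul_le_mul hdiff₂ hvdiff (norm_nonneg _) (by norm_num)
      rw [hmz, hK, hκf]
      have hr : 0 ≤ ‖z‖ ^ (-(4 : ℝ)) := Real.rpow_nonneg (norm_nonneg _) _
      calc 1 / Real.pi ^ 2 * ‖z‖ ^ (-(4 : ℝ)) *
            ‖(bumpSq η R x - bumpSq η R (x + z)) • f (x + z) + (bumpSq η R x - bumpSq η R (x - z)) • f (x - z)‖
          ≤ 1 / Real.pi ^ 2 * ‖z‖ ^ (-(4 : ℝ)) * ((1 / 2 : ℝ) * (2 * (2 * V)) + (1 / 2 : ℝ) * (1 * (2 * V))) := by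
            gcongr
            exact hpair.trans (by gcongr)
        _ = 1 / Real.pi ^ 2 * (3 * V) * ‖z‖ ^ (-(4 : ℝ)) := by ring
  -- integrate
  have hnorm : ‖lamComm (bumpSq η R) f x‖ ≤ (1 / 2 : ℝ) * ∫ z, m z := by
    rw [lamComm_eq, norm_smul, Real.norm_eq_abs, abs_of_pos (by norm_num : (0 : ℝ) < 1 / 2)]
    gcongr
    exact norm_integral_le_of_norm_le hmi (ae_of_all _ hdom)
  refine hnorm.trans ?_
  rw [hmval, hκn, hκf, hρ]
  -- `½[κn·3Bv·R/4 + κf·3Bv·4/R] = c₁V/R + (3Bv/(2π²))·(M₁/2)·G'·…` : compare with `c₁ V/R + c₂ G'`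
  have hG'le : (if 3 * R / 4 ≤ ‖x‖ then c₂ * G else 0) = c₂ * G' := by
    rw [hG']; split_ifs <;> ring
  rw [hG'le, hc₁, hc₂]
  have hR0 : R ≠ 0 := hR.ne'
  field_simp
  ring_nf
  nlinarith [hBv0, hA₂0, hV0, hM₁0, hG'0, Real.pi_pos, sq_nonneg Real.pi, mul_nonneg hBv0 hV0,
    mul_nonneg (mul_nonneg hBv0 hV0) hA₂0, mul_nonneg (mul_nonneg hBv0 hM₁0) hG'0, hR.le]

end Summit.NavierStokesRegularity.NavierStokesRegularity.Theorems.CriticalFluxDoorCommutatorPointwise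

end
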